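import Summits.CriticalPhenomena.CardyFormulaZ2.Theorems.HalfPlaneMarkDensityLaw.Negative.MarkEvents
import Literature.Probability.Percolation.PlanarDuality

/-!
# `HalfPlaneMarkDensityLaw` (crux stmt-CriticalPhenomena-5661), line `Sketch`:
# stub `stub_interleave` — interleaved feet force an intersection (planarity of `ℤ × ℕ`)

A purely graph-theoretic planarity lemma for the lattice half-plane `ℤ × ℕ ⊂ ℤ²`: two lattice
walks staying in `{y ≥ 0}`, one from `(a,0)` to `(k,0)` and the other from `(j,0)` to `(t,0)`,
whose feet INTERLEAVE, `a < j < k < t`, have a common vertex (a discrete Jordan curve theorem;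
Kesten 1982, §2.2).

The proof mirrors `exists_mem_support_of_crossing` of `PlanarDuality.lean` and uses its winding
number `walkWinding p u` (signed number of vertical steps of `p` crossing the horizontal
half-line from `u + (½,½)` to the right). Suppose the supports are disjoint. Extend `P` by two
steps straight down from `(k,0)` to `(k,−2)` (`downRun`), and extend `Q` by one step at each end,
to the walk `(j,−1) → (j,0) ⇝ (t,0) → (t,−1)`. The extended `Q` still avoids the extended `P`, so
(`walkWinding_eq_of_walk`) the extended `P` winds equally around `(j,−1)` and `(t,−1)`. But `P`
itself lives at heights `≥ 0` and does not wind around points at height `−1`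
(`walkWinding_eq_zero_of_ge`), while the down-run at abscissa `k` crosses the half-line
`{y = −½, x > j + ½}` once (winding `−1`, as `j < k`) and misses `{y = −½, x > t + ½}` (winding `0`,
as `k < t`; `walkWinding_downRun`): `−1 = 0`, a contradiction.
-/

noncomputable section

namespace Summit.CriticalPhenomena.CardyFormulaZ2.Cruxes.HalfPlaneMarkDensityLaw.SketchLine

open Literature.Probability.Percolation Literature.Probability.LatticeModels
open MeasureTheory Filter Set SimpleGraph
open scoped Topology
open Summit.CriticalPhenomena.CardyFormulaZ2.Theorems.HalfPlaneMarkDensityLaw.Negative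

namespace TwoArmLower

/-- First coordinate of the boundary vertex `(k,0)`. [folklore] -/
private lemma interleave_bpt_apply_zero (k : ℤ) : bpt k 0 = k := rfl

/-- Second coordinate of the boundary vertex `(k,0)`. [folklore] -/
private lemma interleave_bpt_apply_one (k : ℤ) : bpt k 1 = 0 := rfl

/-- The step `(j,−1) → (j,0)` is a lattice step. [folklore] -/
private lemma interleave_adj_up (j : ℤ) : (zdGraph 2).Adj (![j, -1] : Site 2) (bpt j) :=
  adj_of_stepKind (.up (by simp [interleave_bpt_apply_one]) (by simp [interleave_bpt_apply_zero]))

/-- The step `(t,0) → (t,−1)` is a lattice step. [folklore] -/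
private lemma interleave_adj_down (t : ℤ) : (zdGraph 2).Adj (bpt t) (![t, -1] : Site 2) :=
  adj_of_stepKind (.down (by simp [interleave_bpt_apply_one]) (by simp [interleave_bpt_apply_zero]))

/-- The vertices of the hooked walk `(j,−1) → (j,0) ⇝ (t,0) → (t,−1)` (a walk `Q : (j,0) ⇝ (t,0)`
extended by one vertical step at each end): the two new feet, or vertices of `Q`. [folklore] -/
private lemma mem_support_hookWalk {j t : ℤ} (Q : (zdGraph 2).Walk (bpt j) (bpt t)) {z : Site 2}
    (hz : z ∈ (Walk.cons (interleave_adj_up j)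
      (Q.append (Walk.cons (interleave_adj_down t) Walk.nil))).support) :
    z = ![j, -1] ∨ z = ![t, -1] ∨ z ∈ Q.support := by
  rw [Walk.support_cons, List.mem_cons, Walk.mem_support_append_iff, Walk.support_cons,
    Walk.support_nil, List.mem_cons, List.mem_singleton] at hz
  rcases hz with h | h | h | h
  · exact Or.inl h
  · exact Or.inr (Or.inr h)
  · exact Or.inr (Or.inr (h ▸ Q.end_mem_support))
  · exact Or.inr (Or.inl h)

/-- Winding of `P` followed by the two-step down-run from `(k,0)`, around `(j,−1)` with `j < k`:
minus one. [folklore] -/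
private lemma walkWinding_append_downRun_left {a j k : ℤ} (hjk : j < k)
    (P : (zdGraph 2).Walk (bpt a) (bpt k)) (hP : ∀ z ∈ P.support, 0 ≤ z 1) :
    walkWinding (P.append (downRun (bpt k) 2)) (![j, -1] : Site 2) = -1 := by
  rw [walkWinding_append, walkWinding_eq_zero_of_ge (L := 0) hP (by simp), walkWinding_downRun]
  simp only [Matrix.cons_val_zero, Matrix.cons_val_one, interleave_bpt_apply_zero,
    interleave_bpt_apply_one, Nat.cast_ofNat]
  split_ifs <;> omega

/-- Winding of `P` followed by the two-step down-run from `(k,0)`, around `(t,−1)` with `k < t`: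
zero. [folklore] -/
private lemma walkWinding_append_downRun_right {a k t : ℤ} (hkt : k < t)
    (P : (zdGraph 2).Walk (bpt a) (bpt k)) (hP : ∀ z ∈ P.support, 0 ≤ z 1) :
    walkWinding (P.append (downRun (bpt k) 2)) (![t, -1] : Site 2) = 0 := by
  rw [walkWinding_append, walkWinding_eq_zero_of_ge (L := 0) hP (by simp), walkWinding_downRun]
  simp only [Matrix.cons_val_zero, Matrix.cons_val_one, interleave_bpt_apply_zero,
    interleave_bpt_apply_one, Nat.cast_ofNat]
  split_ifs <;> omega

/-- **Interleaved feet force an intersection** (planarity of the lattice half-plane `ℤ × ℕ`): two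
lattice walks in `{y ≥ 0}`, from `(a,0)` to `(k,0)` and from `(j,0)` to `(t,0)` with
`a < j < k < t`, share a vertex. (Discrete Jordan curve theorem; Kesten 1982, §2.2.) [folklore] -/
theorem stub_interleave :
    ∀ (a j k t : ℤ), a < j → j < k → k < t →
      ∀ (P : (zdGraph 2).Walk (bpt a) (bpt k)) (Q : (zdGraph 2).Walk (bpt j) (bpt t)),
        (∀ z ∈ P.support, 0 ≤ z 1) → (∀ z ∈ Q.support, 0 ≤ z 1) → ∃ z ∈ P.support, z ∈ Q.support := by
  intro a j k t haj hjk hkt P Q hP hQ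
  by_contra hdis
  have hdis' : ∀ z ∈ Q.support, z ∉ P.support := fun z hzQ hzP => hdis ⟨z, hzP, hzQ⟩
  -- the winding numbers of the extended `P` around the two feet of the hooked `Q` differ ...
  have hWj := walkWinding_append_downRun_left hjk P hP
  have hWt := walkWinding_append_downRun_right hkt P hP
  -- ... but the hooked `Q` avoids the extended `P`, so they agree
  have hconst := walkWinding_eq_of_walk (P.append (downRun (bpt k) 2))
    (Walk.cons (interleave_adj_up j) (Q.append (Walk.cons (interleave_adj_down t) Walk.nil))) ?_ ?_ ?_
  · rw [hWj, hWt] at hconst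
    exact absurd hconst (by norm_num)
  · -- avoidance
    intro z hz hzP
    rw [Walk.mem_support_append_iff, mem_support_downRun] at hzP
    simp only [interleave_bpt_apply_zero, interleave_bpt_apply_one, Nat.cast_ofNat] at hzP
    rcases mem_support_hookWalk Q hz with rfl | rfl | hzQ
    · rcases hzP with hzP | hzP
      · have := hP _ hzP
        simp at this
      · simp only [Matrix.cons_val_zero] at hzP
        omega
    · rcases hzP with hzP | hzP
      · have := hP _ hzP
        simp at this
      · simp only [Matrix.cons_val_zero] at hzP
        omega
    · rcases hzP with hzP | hzP
      · exact hdis' z hzQ hzP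
      · have hz1 := hQ z hzQ
        have hzk : z = bpt k := by
          rw [Site.eq_iff_two, interleave_bpt_apply_zero, interleave_bpt_apply_one]
          omega
        exact hdis' z hzQ (hzk ▸ P.end_mem_support)
  · -- the start `(a,0)` of the extended `P` is off the half-lines `rayAbove z`
    intro z hz
    simp only [mem_rayAbove, interleave_bpt_apply_zero, interleave_bpt_apply_one, not_and, not_le]
    intro h1
    rcases mem_support_hookWalk Q hz with rfl | rfl | hzQ
    · simp only [Matrix.cons_val_zero]
      omega
    · simp only [Matrix.cons_val_zero]
      omega
    · have := hQ z hzQ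
      omega
  · -- the end `(k,−2)` of the extended `P` is off the half-lines `rayAbove z`
    intro z hz
    simp only [mem_rayAbove, iterate_sub_single_apply_one, interleave_bpt_apply_one, Nat.cast_ofNat,
      not_and]
    intro h1
    exfalso
    rcases mem_support_hookWalk Q hz with rfl | rfl | hzQ
    · simp only [Matrix.cons_val_one, Matrix.cons_val_zero] at h1
      omega
    · simp only [Matrix.cons_val_one, Matrix.cons_val_zero] at h1
      omega
    · have := hQ z hzQ
      omega

end TwoArmLower

end Summit.CriticalPhenomena.CardyFormulaZ2.Cruxes.HalfPlaneMarkDensityLaw.SketchLine
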